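import Summits.BirchSwinnertonDyer.BirchSwinnertonDyer.Theorems.KimAtThreeEulerLatticeOfFrobenius
import Summits.BirchSwinnertonDyer.BirchSwinnertonDyer.Theorems.KimAtThreeFineKatoKPortJunctionDegree
import Literature.NumberTheory.AdelicBaseChange.PadicTensorCompletionGaloisProofs
import Literature.NumberTheory.AdelicBaseChange.AdicCompletionDensity
import HarnessLib

/-!
# Frobenius data on `K_w = KPort.Kw p L w` from a global Frobenius, and the lattice lemma from it

Helper for the W2 crux `KimAtThreeKolyvagin.DeepLowerAtThreeOffKatoStratum` (good-anomalous rows of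
`stub_additiveDefect`, support statement `FineKatoTauAnomalousThree`).  The lattice lemma
`KimAtThreeEulerLatticeOfFrobenius.exists_padicLog_eq_iff_norm_eulerOperator_le`
(`log_ω E(L_w) = E_p(φ)⁻¹𝒪_w`) takes an abstract Frobenius `φ : K_w →ₐ[ℚ_p] K_w` (isometry, lift of
`x ↦ x^p`, `φ^f = 1`, powers below `f` distinct, `f = [K_w : ℚ_p] = f(w∣p)`).  This file manufactures
that datum from GLOBAL data — an automorphism `σ ∈ Aut(L/ℚ)` of the number field fixing the place
`w ∣ p` — as the transport `σ_w = galAdicCompletionMap σ` (tree, `GaloisActionPlaces`) read on the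
cell's synonym `K_w`:

* `exists_algHom_eq_galAdicCompletionMap` — `σ_w` is a `ℚ_[p]`-algebra endomorphism of `K_w`
  (`ℚ_v`-linearity of `σ_w`, packet `galAdicCompletionMap_algebraMap_adicCompletion`, and the cell's
  `ℚ_[p]`-structure `(ℚ_v → L_w) ∘ e_p`);
* for any `φ` agreeing with `σ_w`: `map_coe_eq` (`φ = σ` on `L`), `valued_map_eq` / `norm_map_eq`
  (isometry), `toCompletion_pow_apply` / `pow_apply_eq_self` / `pow_injOn` (`φ^n = (σ^n)_w`, so
  `φ^{ord σ} = 1` and the powers below `ord σ` are distinct, `L ↪ L_w`), `norm_map_sub_pow_lt_one`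
  (if `σ • a ≡ a^p (mod 𝔭_w)` on `𝓞 L` then `‖φ y − y^p‖ < 1` on the unit ball: density of `𝓞 L` in
  `𝒪_w`, packet `exists_adicValued_sub_lt_of_adicCompletionInteger`);
* `smul_eq_of_isArithFrobAt`, `under_int_eq`, `smul_sub_pow_mem_of_isArithFrobAt` — the bridge from
  Mathlib's `IsArithFrobAt ℤ σ 𝔭_w`;
* `exists_frobenius` (package) and **`exists_padicLog_eq_iff_of_frobenius`**: the lattice lemma
  `log_ω E(L_w) = E_p(σ_w)⁻¹𝒪_w` from `σ` with `σ • w = w`, `σ • a ≡ a^p (mod 𝔭_w)`,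
  `ord σ = f(w∣p)`, for `W/ℚ` globally minimal with `p ∤ Δ_min`, `e(w∣p) = 1`, `E(L_w)[p] = 0`.

References: Cassels–Fröhlich, *Algebraic Number Theory* (1967), Ch. VII §1.1 (Galois action on
completions) and Ch. II §10; Bloch–Kato (1990), Example 3.11; Silverman, AEC (2009), IV.6.4, V.2.3.1.
-/

noncomputable section

-- the cell's Theorems namespace repeats the summit name by design (D-0017)
set_option linter.dupNamespace false

open scoped Classical NNReal NumberField Pointwise
open IsDedekindDomain NumberField
open Literature.NumberTheory.Automorphic Literature.NumberTheory.AdelicBaseChange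
open Summit.BirchSwinnertonDyer.BirchSwinnertonDyer.Theorems.KPort

namespace Summit.BirchSwinnertonDyer.BirchSwinnertonDyer.Theorems.KimAtThreeKwFrobenius

variable {p : ℕ} [hp : Fact p.Prime] {L : Type} [Field L] [NumberField L]
  {w : ((Rat.HeightOneSpectrum.primesEquiv (R := 𝓞 ℚ)).symm ⟨p, hp.out⟩).Extension (𝓞 L)}

/-- **`σ_w` on `K_w` is a `ℚ_[p]`-algebra endomorphism**: for `σ ∈ Aut(L/ℚ)` with `σ • w = w`
there is `φ : K_w →ₐ[ℚ_[p]] K_w` agreeing with the transport `galAdicCompletionMap σ` along the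
identity `K_w = L_w` (`ℚ_v`-linearity of `σ_w` and `algebraMap ℚ_[p] K_w = (ℚ_v → L_w) ∘ e_p`).
[cite: CasselsFrohlichANT1967, Ch. VII §1.1] -/
theorem exists_algHom_eq_galAdicCompletionMap (σ : L ≃ₐ[ℚ] L) (hσ : σ • w.1 = w.1) :
    ∃ φ : Kw p L w →ₐ[ℚ_[p]] Kw p L w,
      ∀ y, Kw.toCompletion p L w (φ y) = galAdicCompletionMap σ hσ (Kw.toCompletion p L w y) := by
  let ψ : Kw p L w →+* Kw p L w :=
    (Kw.toCompletion p L w).symm.toRingHom.comp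
      ((galAdicCompletionMap σ hσ).comp (Kw.toCompletion p L w).toRingHom)
  refine ⟨{ toRingHom := ψ, commutes' := ?_ }, fun _ => rfl⟩
  intro r
  change galAdicCompletionMap σ hσ (Kw.toCompletion p L w (algebraMap ℚ_[p] (Kw p L w) r)) =
    Kw.toCompletion p L w (algebraMap ℚ_[p] (Kw p L w) r)
  rw [Kw.algebraMap_eq]
  exact galAdicCompletionMap_algebraMap_adicCompletion _ σ w w hσ _

/-- `(σ^n) • w = w` when `σ • w = w`. [folklore] -/
theorem pow_smul_eq_self (σ : L ≃ₐ[ℚ] L) (hσ : σ • w.1 = w.1) (n : ℕ) : (σ ^ n) • w.1 = w.1 := by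
  induction n with
  | zero => rw [pow_zero, one_smul]
  | succ n ih => rw [pow_succ, mul_smul, hσ, ih]

section Transport

variable (σ : L ≃ₐ[ℚ] L) (hσ : σ • w.1 = w.1) (φ : Kw p L w →ₐ[ℚ_[p]] Kw p L w)
  (hφ : ∀ y, Kw.toCompletion p L w (φ y) = galAdicCompletionMap σ hσ (Kw.toCompletion p L w y))
include hφ

/-- `φ` extends `σ`: on `x ∈ L`, `φ x = σ x`. [folklore] -/
theorem map_coe_eq (x : L) :
    Kw.toCompletion p L w (φ ((Kw.toCompletion p L w).symm (x : w.1.adicCompletion L))) =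
      ((σ x : L) : w.1.adicCompletion L) := by
  rw [hφ, RingEquiv.apply_symm_apply, galAdicCompletionMap_coe, AlgEquiv.smul_def]

/-- `φ` preserves the `w`-adic valuation. [folklore] -/
theorem valued_map_eq (y : Kw p L w) :
    (Valued.v (φ y) : WithZero (Multiplicative ℤ)) = Valued.v y := by
  have h := valued_galAdicCompletionMap (L := L) σ hσ (Kw.toCompletion p L w y)
  rw [← hφ] at h
  exact h

/-- **`φ` is an isometry of `K_w`** (base-`p` norm). [cite: CasselsFrohlichANT1967, Ch. VII §1.1] -/
theorem norm_map_eq (y : Kw p L w) : ‖φ y‖ = ‖y‖ := by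
  rw [Kw.norm_def', Kw.norm_def', valued_map_eq σ hσ φ hφ]

/-- Powers: `φ^n` is the transport of `σ^n`. [folklore] -/
theorem toCompletion_pow_apply (n : ℕ) (y : Kw p L w) :
    Kw.toCompletion p L w ((φ ^ n) y) =
      galAdicCompletionMap (σ ^ n) (pow_smul_eq_self σ hσ n) (Kw.toCompletion p L w y) := by
  induction n generalizing y with
  | zero =>
    rw [pow_zero, AlgHom.one_apply,
      galAdicCompletionMap_congr_left L (pow_zero σ) _ (one_smul _ _), galAdicCompletionMap_one]
  | succ n ih =>
    rw [pow_succ, AlgHom.mul_apply, ih, hφ, galAdicCompletionMap_galAdicCompletionMap,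
      galAdicCompletionMap_congr_left L (pow_succ σ n).symm]

/-- **`φ^f = 1` when `σ^f = 1`.** [folklore] -/
theorem pow_apply_eq_self {f : ℕ} (hf : σ ^ f = 1) (y : Kw p L w) : (φ ^ f) y = y := by
  apply (Kw.toCompletion p L w).injective
  rw [toCompletion_pow_apply σ hσ φ hφ, galAdicCompletionMap_congr_left L hf _ (one_smul _ _),
    galAdicCompletionMap_one]

/-- **The powers `φ⁰, …, φ^{f-1}` are pairwise distinct when `σ⁰, …, σ^{f-1}` are** (`L ↪ L_w`).
[folklore] -/
theorem pow_injOn {f : ℕ} (hd : ∀ i j : ℕ, i < f → j < f → σ ^ i = σ ^ j → i = j)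
    (i j : ℕ) (hi : i < f) (hj : j < f)
    (h : (⇑(φ ^ i) : Kw p L w → Kw p L w) = ⇑(φ ^ j)) : i = j := by
  refine hd i j hi hj (AlgEquiv.ext fun x => ?_)
  have hx := congrFun h ((Kw.toCompletion p L w).symm (x : w.1.adicCompletion L))
  have hx' := congrArg (Kw.toCompletion p L w) hx
  simp only [toCompletion_pow_apply σ hσ φ hφ, RingEquiv.apply_symm_apply, galAdicCompletionMap_coe,
    AlgEquiv.smul_def] at hx'
  exact (algebraMap L (w.1.adicCompletion L)).injective hx'

/-- **`φ` lifts the `p`-power map when `σ` is an arithmetic Frobenius at `w`** (`σ a ≡ a^p (mod w)`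
on `𝓞 L`): `‖φ y − y^p‖ < 1` for `‖y‖ ≤ 1` (`𝓞 L` is dense in `𝒪_w`, `φ` is an isometry, and
`a^p − y^p ∈ (a − y)𝒪_w`). [cite: CasselsFrohlichANT1967, Ch. VII §1.1] -/
theorem norm_map_sub_pow_lt_one (hσp : ∀ a : 𝓞 L, σ • a - a ^ p ∈ w.1.asIdeal)
    (y : Kw p L w) (hy : ‖y‖ ≤ 1) : ‖φ y - y ^ p‖ < 1 := by
  rw [Kw.norm_lt_one_iff]
  have hyv : (Valued.v (Kw.toCompletion p L w y) : WithZero (Multiplicative ℤ)) ≤ 1 :=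
    (Kw.norm_le_one_iff y).mp hy
  have hYO : Kw.toCompletion p L w y ∈ w.1.adicCompletionIntegers L := hyv
  obtain ⟨a, ha⟩ :=
    HeightOneSpectrum.exists_adicValued_sub_lt_of_adicCompletionInteger L w.1 ⟨_, hYO⟩ 1
  rw [Units.val_one] at ha
  set Y : w.1.adicCompletion L := Kw.toCompletion p L w y with hYdef
  have hι : ∀ z : L, Valued.v (algebraMap L (w.1.adicCompletion L) z) = w.1.valuation L z :=
    fun z => HeightOneSpectrum.valuedAdicCompletion_eq_valuation' w.1 z
  set A : w.1.adicCompletion L := algebraMap L (w.1.adicCompletion L) (algebraMap (𝓞 L) L a)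
    with hAdef
  have ha' : Valued.v (A - Y) < 1 := ha
  have hAO : Valued.v A ≤ 1 := by
    rw [hAdef, hι, HeightOneSpectrum.valuation_of_algebraMap]
    exact HeightOneSpectrum.intValuation_le_one _ _
  -- (1) `φ` is an isometry
  have h1 : Valued.v (galAdicCompletionMap σ hσ Y - galAdicCompletionMap σ hσ A) < 1 := by
    rw [← map_sub, valued_galAdicCompletionMap, Valuation.map_sub_swap]
    exact ha'
  -- (2) the Frobenius congruence on `𝓞 L`
  have h2 : Valued.v (galAdicCompletionMap σ hσ A - A ^ p) < 1 := by
    have e1 : galAdicCompletionMap σ hσ A =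
        algebraMap L (w.1.adicCompletion L) (algebraMap (𝓞 L) L (σ • a)) := by
      change galAdicCompletionMap σ hσ ((algebraMap (𝓞 L) L a : L) : w.1.adicCompletion L) = _
      rw [galAdicCompletionMap_coe, smul_algebraMap_eq]
      rfl
    rw [e1, hAdef, ← map_pow, ← map_pow, ← map_sub, ← map_sub, hι,
      HeightOneSpectrum.valuation_of_algebraMap]
    exact (HeightOneSpectrum.intValuation_lt_one_iff_mem _ _).mpr (hσp a)
  -- (3) `a^p − y^p ∈ (a − y)𝒪_w`
  have h3 : Valued.v (A ^ p - Y ^ p) < 1 := by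
    obtain ⟨c, hc⟩ := sub_dvd_pow_sub_pow
      (⟨A, hAO⟩ : w.1.adicCompletionIntegers L)
      ⟨Y, hYO⟩ p
    have hc' : A ^ p - Y ^ p = (A - Y) * (c : w.1.adicCompletion L) := by
      have h := congrArg ((↑) : w.1.adicCompletionIntegers L → w.1.adicCompletion L) hc
      simpa using h
    rw [hc', Valuation.map_mul]
    exact (mul_le_of_le_one_right' c.2).trans_lt ha'
  have hsplit : galAdicCompletionMap σ hσ Y - Y ^ p =
      (galAdicCompletionMap σ hσ Y - galAdicCompletionMap σ hσ A) +
        ((galAdicCompletionMap σ hσ A - A ^ p) + (A ^ p - Y ^ p)) := by ring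
  have hgoal : (Valued.v (φ y - y ^ p) : WithZero (Multiplicative ℤ)) =
      Valued.v (galAdicCompletionMap σ hσ Y - Y ^ p) := by
    rw [← Kw.valued_toCompletion, map_sub, map_pow, hφ]
  rw [hgoal, hsplit]
  exact Valuation.map_add_lt _ h1 (Valuation.map_add_lt _ h2 h3)

end Transport

/-- An arithmetic Frobenius at `𝔭_w` in Mathlib's sense (`IsArithFrobAt ℤ σ 𝔭_w`) fixes the place
`w`. [folklore] -/
theorem smul_eq_of_isArithFrobAt (σ : L ≃ₐ[ℚ] L) (h : IsArithFrobAt ℤ σ w.1.asIdeal) :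
    σ • w.1 = w.1 :=
  HeightOneSpectrum.ext (MulAction.mem_stabilizer_iff.mp h.mem_stabilizer)

/-- `𝔭_w ∩ ℤ = pℤ` for a place `w` of `L` above `p`. [folklore] -/
theorem under_int_eq : w.1.asIdeal.under ℤ = Ideal.span {(p : ℤ)} := by
  have hp_mem : (p : ℤ) ∈ w.1.asIdeal.under ℤ := by
    rw [Ideal.under_def, Ideal.mem_comap, map_natCast]
    exact Kw.prime_mem_asIdeal w
  have hmax : (Ideal.span {(p : ℤ)}).IsMaximal :=
    PrincipalIdealRing.isMaximal_of_irreducible (Int.prime_iff_natAbs_prime.mpr (by simpa using hp.out)).irreducible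
  exact (hmax.eq_of_le (Ideal.IsPrime.ne_top inferInstance)
    ((Ideal.span_singleton_le_iff_mem _).mpr hp_mem)).symm

/-- An arithmetic Frobenius at `𝔭_w` in Mathlib's sense (`σ • a ≡ a^{#(ℤ/𝔭_w ∩ ℤ)} (mod 𝔭_w)`)
satisfies `σ • a ≡ a^p (mod 𝔭_w)` (`#(ℤ/pℤ) = p`). [folklore] -/
theorem smul_sub_pow_mem_of_isArithFrobAt (σ : L ≃ₐ[ℚ] L) (h : IsArithFrobAt ℤ σ w.1.asIdeal)
    (a : 𝓞 L) : σ • a - a ^ p ∈ w.1.asIdeal := by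
  have hcard : Nat.card (ℤ ⧸ w.1.asIdeal.under ℤ) = p := by
    rw [under_int_eq (w := w), Nat.card_congr (Int.quotientSpanNatEquivZMod p).toEquiv, Nat.card_zmod]
  have ha := h a
  rw [hcard] at ha
  exact ha

/-- **Frobenius data on `K_w` (package).**  For `σ ∈ Aut(L/ℚ)` fixing the place `w ∣ p` and
inducing `a ↦ a^p` on `𝓞 L / w`, the transport `φ = σ_w` of `σ` to `K_w` is a `ℚ_p`-algebra
endomorphism which is an isometry, lifts the `p`-power map on the unit ball, satisfies
`φ^{ord σ} = 1`, and has `φ⁰, …, φ^{ord σ − 1}` pairwise distinct — the hypotheses on `φ` of the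
lattice lemma `KimAtThreeEulerLatticeOfFrobenius.exists_padicLog_eq_iff_norm_eulerOperator_le`.
[cite: CasselsFrohlichANT1967, Ch. VII §1.1] -/
theorem exists_frobenius (σ : L ≃ₐ[ℚ] L) (hσ : σ • w.1 = w.1)
    (hσp : ∀ a : 𝓞 L, σ • a - a ^ p ∈ w.1.asIdeal) :
    ∃ φ : Kw p L w →ₐ[ℚ_[p]] Kw p L w,
      (∀ y, Kw.toCompletion p L w (φ y) = galAdicCompletionMap σ hσ (Kw.toCompletion p L w y)) ∧
      (∀ y, ‖φ y‖ = ‖y‖) ∧ (∀ y, ‖y‖ ≤ 1 → ‖φ y - y ^ p‖ < 1) ∧ (∀ y, (φ ^ orderOf σ) y = y) ∧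
      ∀ i j : ℕ, i < orderOf σ → j < orderOf σ →
        (⇑(φ ^ i) : Kw p L w → Kw p L w) = ⇑(φ ^ j) → i = j := by
  obtain ⟨φ, hφ⟩ := exists_algHom_eq_galAdicCompletionMap σ hσ
  refine ⟨φ, hφ, norm_map_eq σ hσ φ hφ, norm_map_sub_pow_lt_one σ hσ φ hφ hσp,
    pow_apply_eq_self σ hσ φ hφ (pow_orderOf_eq_one σ), pow_injOn σ hσ φ hφ ?_⟩
  intro i j hi hj h
  exact pow_injOn_Iio_orderOf (Set.mem_Iio.mpr hi) (Set.mem_Iio.mpr hj) h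

/-- **The lattice lemma `log_ω E(L_w) = E_p(σ_w)⁻¹𝒪_w` from GLOBAL Frobenius data.**  `W/ℚ` globally
minimal with `p ∤ Δ_min(W)`; `w ∣ p` a place of the number field `L` with `e(w∣p) = 1`;
`σ ∈ Aut(L/ℚ)` with `σ • w = w`, `σ a ≡ a^p (mod w)` on `𝓞 L` and `ord σ = f(w∣p)` (the Frobenius
of `w`, e.g. `ζ ↦ ζ^p` on `ℚ(ζ_m)`, `p ∤ m`); `E(L_w)[p] = 0`.  Then for the transport `φ = σ_w` on
`K_w` (any `ℚ_p`-algebra map agreeing with `galAdicCompletionMap σ`): `y ∈ K_w` is `log_ω P` for some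
`P ∈ E(L_w)` iff `‖φφy − a_p·φy + p·y‖ ≤ ‖p‖`.
[cite: BlochKato1990, Example 3.11] [cite: SilvermanAEC2009, Thm. IV.6.4 and V.2.3.1] -/
theorem exists_padicLog_eq_iff_of_frobenius [he : Fact (w.1.asIdeal.ramificationIdx (𝓞 ℚ) = 1)]
    (W : WeierstrassCurve ℚ) [W.IsElliptic] [W.IsGloballyMinimal]
    (hΔ : ¬ (p : ℤ) ∣ WeierstrassCurve.minimalDiscriminantInt W)
    (σ : L ≃ₐ[ℚ] L) (hσ : σ • w.1 = w.1) (hσp : ∀ a : 𝓞 L, σ • a - a ^ p ∈ w.1.asIdeal)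
    (hord : orderOf σ = w.1.asIdeal.inertiaDeg (𝓞 ℚ))
    (φ : Kw p L w →ₐ[ℚ_[p]] Kw p L w)
    (hφ : ∀ y, Kw.toCompletion p L w (φ y) = galAdicCompletionMap σ hσ (Kw.toCompletion p L w y))
    (hT : ∀ P : (W.baseChange (w.1.adicCompletion L)).toAffine.Point, p • P = 0 → P = 0)
    (y : Kw p L w) :
    haveI := Literature.NumberTheory.EllipticCurves.EulerLattice.isIntegral_baseChange w.1 W
    (∃ P : (W.baseChange (w.1.adicCompletion L)).toAffine.Point,
      Literature.NumberTheory.EllipticCurves.FormalGroupChart.padicLogPointFiniteExt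
        (NormedField.valuation : Valuation (w.1.adicCompletion L) ℝ≥0)
        (W.baseChange (w.1.adicCompletion L)) p P = Kw.toCompletion p L w y) ↔
    ‖φ (φ y) - (W.frobeniusTrace p : Kw p L w) * φ y + (p : Kw p L w) * y‖ ≤ ‖(p : Kw p L w)‖ := by
  have hf0 : 0 < orderOf σ := hord ▸ Ideal.inertiaDeg_pos (R := 𝓞 ℚ) (q := w.1.asIdeal)
  have hd : ∀ i j : ℕ, i < orderOf σ → j < orderOf σ → σ ^ i = σ ^ j → i = j :=
    fun i j hi hj hij => pow_injOn_Iio_orderOf (Set.mem_Iio.mpr hi) (Set.mem_Iio.mpr hj) hij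
  exact KimAtThreeEulerLatticeOfFrobenius.exists_padicLog_eq_iff_norm_eulerOperator_le p L w W hΔ φ
    (norm_map_eq σ hσ φ hφ) (norm_map_sub_pow_lt_one σ hσ φ hφ hσp) hf0
    ((Kw.finrank_eq_inertiaDeg p L w he.out).trans hord.symm) hord.symm
    (pow_apply_eq_self σ hσ φ hφ (pow_orderOf_eq_one σ)) (pow_injOn σ hσ φ hφ hd) hT y

end Summit.BirchSwinnertonDyer.BirchSwinnertonDyer.Theorems.KimAtThreeKwFrobenius
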